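import Mathlib.Algebra.BigOperators.Finprod
import Mathlib.Tactic.Linarith
import Literature.IUT.HodgeTheaters.InitialThetaData
import Literature.IUT.LogVolume.ArakelovDivisors
import Literature.IUT.LogVolume.Theorem110Data
import Summits.ABC.IUTFork.Cor312Statement
import Summits.ABC.IUTFork.ForkThm110
import HarnessLib

/-!
# [IUTchIII] Cor. 3.12 — the PROVENANCE LINK: "the situation of Theorem 3.11" OF a collection of initial Θ-data (c312 crew, wave 2, board row W2-F)

Record-only file (D-0012) of the abc-iut cell (seat abc-iut-c312-8; plan/COR312-ASSIGNMENTS.md row W2-F,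
proposed by abc-iut-plan 2026-08-25T19:20Z); TAKES NO SIDE. [IUTchIII] Cor. 3.12 opens "Suppose that we are in
the situation of Theorem 3.11", and Theorem 3.11 opens (kurims p. 153 l. 3–8) "Fix a collection of initial
Θ-data `(F̄/F, X_F, l, C̲_K, V̲, V^bad_mod, ε̲)` as in [IUTchI], Definition 3.1. Let `{^{n,m}𝓗𝓣^{Θ±ell NF}}_{n,m∈ℤ}` be
a collection of distinct Θ^{±ell}NF-Hodge theaters [relative to the given initial Θ-data] … arising from an
LGP-Gaussian log-theta-lattice". The cell now holds BOTH ends as real declarations — abc-iut-L5-t2's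
`Literature.IUT.HodgeTheaters.InitialThetaData F K Fbar E l Pb` ([IUTchI] Def. 3.1, REAL at Mathlib level) and
abc-iut-c312-7's `Summit.ABC.IUTFork.Cor312.Setting S` (the VERBATIM statement of Cor. 3.12 over c312-1's
`Thm311.Situation`, with `negLogTheta`, `negLogQ`, `Statement`) — but no declaration saying that a given
setting is the one ATTACHED TO a given datum. This file supplies that link, and the numbers it transports:

* `logq D` — **`log(q)`** of [IUTchIV] Theorem 1.10 (kurims p. 23 l. 4–33): "`𝔮^{F□}_{ADiv} ∈ ADiv_ℝ(F□)` for the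
  effective arithmetic divisor determined by the `q`-parameters of the elliptic curve `E_F` at the elements of
  `𝕍(F□)^bad := 𝕍^bad_mod ×_{𝕍_mod} 𝕍(F□) (≠ ∅)`", "`log(q) := deg(𝔮^{F□}_{ADiv}) ∈ ℝ_{≥0}`" (normalized degree, "independent
  of the choice of `F□`"), here over `F□ = F` with `ord_v(q_v)` = L5-t2's `qParamOrd` ([IUTchI] Def. 3.1 (c))
  and the normalized degree of abc-iut-c312-3's `ArakelovDivisors` (`(1/[F:ℚ]) Σ_v c_v · log N(v)`) — REAL
  (a `finsum`; `logq_nonneg` PROVED); `absLogq D := (1/2l) · log(q)`.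
* `IsSettingOf D P : Prop` — "`P` is the situation of Theorem 3.11 / Cor. 3.12 OF the initial Θ-datum `D`": a
  hypothesis structure whose fields are the IDENTIFICATIONS between the two sides that the cell can state
  over its present vocabulary, each quoting the printed sentence it transcribes: the index skeleton (`l⋇`,
  the places `V̲ ⥲ V_mod` with `V̲^bad`), finiteness of `𝕍(F)^bad`, and the one quantitative identification the
  closed statement needs — [IUTchIV] p. 23 l. 27–30: "the quantity «`|log(q)| ∈ ℝ_{>0}`» defined in [IUTchIII],
  Corollary 3.12, is equal to `(1/2l) · log(q) ∈ ℝ` [cf. the definition of «`q̲_v̲`» in [IUTchI], Example 3.2,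
  (iv)]" (`negLogQ_eq`). The constructions in between are c312-7's `Setting` FIELDS and their residual
  owners (its module docstring R0–R3); NO claim that such a `P` exists for a given `D` is made.
* `Thm110Inputs D` + `numbersOf D P I : Summit.ABC.IUTFork.Thm110Data` — the numbers of [IUTchIV] Thm. 1.10 FOR
  the datum `D` and the setting `P`: `l`, `d_mod := [F_mod : ℚ]` (`dmod`, REAL over L5-t2's `fieldOfModuli`),
  `log(q) := logq D`, `−|log(Θ)| :=` `P.negLogTheta` (untopped — see the junk-value note at `numbersOf`), and, as
  INPUTS not determined by Cor. 3.12's setting, `e*_mod`, `η_prm`, `log(𝔡^{F_tpd}) + log(𝔣^{F_tpd})` and the two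
  printed side conditions `l ≥ 7` ("`l ≠ 5`", Thm. 1.10) and `log(q) > 0` ("`(≠ ∅)`", p. 23 / Cor. 3.12
  "`|log(q)| > 0`"); with **`numbersOf_cor312_iff : (numbersOf D P I).Cor312 ↔ P.Statement`** under
  `IsSettingOf D P` (PROVED) — so the skeleton's `Thm110Data.Cor312` (hence `ForkAbc`, `ForkThm110`, c312-2's
  `Volumes.ofThm110`, the kernel-DAG node `N_IUTchIII_Cor3_12`) and the VERBATIM statement close on one
  proposition per datum; `numericsOf`/`numericsOf_cor312_iff` do the same for campaign S's `Thm110Numerics`.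
Deliberately NOT here: Theorem 3.11 (c312-1), the statement (c312-7), any reading of Step (xi) (c312-2, c312-6),
the DH/LANA forms (c312-3, c312-4), any judgement. [claim: Mochizuki2012, status: disputed] for every quotation.
-/

noncomputable section

namespace Summit.ABC.IUTFork.Cor312Prov

open Literature.IUT.HodgeTheaters Literature.IUT.LogVolume NumberField IsDedekindDomain

universe u v w

variable {F : Type u} {K : Type v} {Fbar : Type w} [Field F] [NumberField F] [Field K] [NumberField K]
  [Algebra F K] [Field Fbar] [Algebra F Fbar] [Algebra K Fbar] {E : WeierstrassCurve F} [E.IsElliptic]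
  {l : ℕ} {Pb : BadPlacePredicates K}

/-! ## 1. The numbers of [IUTchIV] Theorem 1.10 that the initial Θ-data determine outright -/

variable (E) in
/-- **`d_mod := [F_mod : ℚ]`** ([IUTchIV] Thm. 1.10, kurims p. 22 l. 27: "In the notation of [IUTchI], Definition
3.1, let us write `d_mod := [F_mod : ℚ]`"), over abc-iut-L5-t2's field of moduli `fieldOfModuli E = ℚ(j_E) ⊆ F`
([IUTchI] Def. 3.1 (b)). REAL. [claim: Mochizuki2012, status: disputed] -/
def dmod : ℕ := Module.finrank ℚ (fieldOfModuli E)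

variable (E) in
/-- `d_mod ≥ 1` (p. 22: "`(1 ≤) e_mod (≤ d_mod)`"). PROVED (a field has positive dimension over `ℚ`).
[claim: Mochizuki2012, status: disputed] -/
theorem one_le_dmod : 1 ≤ dmod E := Module.finrank_pos

open scoped Classical in
/-- The local term of `log(q)` at a finite place `v` of `F`: `ord_v(q_v) · log N(v)` if `v ∈ 𝕍(F)^bad`
(`= 𝕍^bad_mod ×_{𝕍_mod} 𝕍(F)`, L5-t2's `InitialThetaData.VFbad`; `ord_v(q_v)` = L5-t2's `qParamOrd`, [IUTchI] Def.
3.1 (c); `log N(v)` = abc-iut-c312-3's `logNorm`), and `0` otherwise ([IUTchIV] p. 23 l. 4–8, 19–22: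
"`log(q_v) := deg_{𝕍(F□)_v}(𝔮^{F□}_{ADiv})`"). [claim: Mochizuki2012, status: disputed] -/
def logqLocal (D : InitialThetaData F K Fbar E l Pb) (v : FinitePlace F) : ℝ :=
  if v ∈ D.VFbad then (qParamOrd E v.maximalIdeal : ℝ) * logNorm F v.maximalIdeal else 0

/-- Each local term of `log(q)` is nonnegative (p. 23: "`∈ ℝ_{≥0}`"). PROVED (`log N(v) > 0`, c312-3's
`logNorm_pos`). [claim: Mochizuki2012, status: disputed] -/
theorem logqLocal_nonneg (D : InitialThetaData F K Fbar E l Pb) (v : FinitePlace F) : 0 ≤ logqLocal D v := by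
  unfold logqLocal
  split_ifs
  · exact mul_nonneg (Nat.cast_nonneg _) (logNorm_pos F _).le
  · exact le_rfl

/-- **`log(q) := deg(𝔮^{F□}_{ADiv}) ∈ ℝ_{≥0}`** ([IUTchIV] Thm. 1.10, kurims p. 23 l. 19–22), the NORMALIZED degree
([IUTchIV] Def. 1.9 (i) / [GenEll] Def. 1.2: `deg(𝔞) = (1/[F□:ℚ]) Σ_v c_v log N(v)`, "independent of the choice of
`F□`", p. 23 l. 26–27) of the effective arithmetic divisor of the `q`-parameters of `E_F` at `𝕍(F)^bad`, computed
over `F□ = F`: `(1/[F:ℚ]) · Σ_{v ∈ 𝕍(F)^bad} ord_v(q_v) · log N(v)`. REAL, as a `finsum` (which is the finite sum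
since `𝕍(F)^bad` is finite — finitely many places of bad reduction, the tree's classical FACT
`WeierstrassCurve.finite_badPlaces`; `IsSettingOf.VFbad_finite` carries it). [claim: Mochizuki2012, status: disputed] -/
def logq (D : InitialThetaData F K Fbar E l Pb) : ℝ :=
  (∑ᶠ v : FinitePlace F, logqLocal D v) / Module.finrank ℚ F

/-- `log(q) ≥ 0` (p. 23 l. 21: "`log(q) := deg(𝔮^{F□}_{ADiv}) ∈ ℝ_{≥0}`"). PROVED.
[claim: Mochizuki2012, status: disputed] -/
theorem logq_nonneg (D : InitialThetaData F K Fbar E l Pb) : 0 ≤ logq D :=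
  div_nonneg (finsum_nonneg fun v => logqLocal_nonneg D v) (Nat.cast_nonneg _)

/-- The `q`-parameter arithmetic divisor `𝔮^{F}_{ADiv}` of [IUTchIV] p. 23 ("the effective arithmetic divisor
determined by the `q`-parameters of the elliptic curve `E_F` at the elements of `𝕍(F)^bad`") as a finitely supported
divisor of abc-iut-c312-3's `Literature.IUT.LogVolume.FinDivisor F` (Dupuy–Hilado §2.5.4), given the finiteness of
`𝕍(F)^bad`: `Σ_{v ∈ 𝕍(F)^bad} ord_v(q_v) · [v]`. REAL. [claim: Mochizuki2012, status: disputed] -/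
def qArithDivisor (D : InitialThetaData F K Fbar E l Pb) (hfin : D.VFbad.Finite) : FinDivisor F :=
  ∑ v ∈ hfin.toFinset, FinDivisor.of v.maximalIdeal (qParamOrd E v.maximalIdeal : ℝ)

/-- DH-side bridge: `log(q)` IS the normalized Arakelov degree `deĝ̲_F` (c312-3's `FinDivisor.ndeg`; = Dupuy–Hilado
§3.3's `deĝ̲(P_q)` up to their `2l`-normalisation, cf. c312-3's `PilotData.qDivisor`) of the `q`-parameter divisor.
PROVED (the `finsum` is the finite sum over `𝕍(F)^bad`). [claim: Mochizuki2012, status: disputed] -/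
theorem logq_eq_ndeg (D : InitialThetaData F K Fbar E l Pb) (hfin : D.VFbad.Finite) :
    logq D = FinDivisor.ndeg F (qArithDivisor D hfin) := by
  classical
  rw [FinDivisor.ndeg_apply, qArithDivisor, FinDivisor.deg_sum_of]
  unfold logq
  congr 1
  rw [finsum_eq_sum_of_support_subset _ (s := hfin.toFinset)]
  · refine Finset.sum_congr rfl fun v hv => ?_
    rw [logqLocal, if_pos (hfin.mem_toFinset.mp hv)]
  · intro v hv
    rw [Function.mem_support] at hv
    simp only [Finset.mem_coe, Set.Finite.mem_toFinset]
    by_contra h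
    exact hv (by rw [logqLocal, if_neg h])

/-- **`|log(q)| = (1/2l) · log(q)`** ([IUTchIV] p. 23 l. 27–30: "the quantity «`|log(q)| ∈ ℝ_{>0}`» defined in
[IUTchIII], Corollary 3.12, is equal to `(1/2l) · log(q) ∈ ℝ` [cf. the definition of «`q̲_v̲`» in [IUTchI], Example
3.2, (iv)]" — `q̲_v̲` being a `2l`-th root of `q_v̲`). [claim: Mochizuki2012, status: disputed] -/
def absLogq (D : InitialThetaData F K Fbar E l Pb) : ℝ := logq D / (2 * (l : ℝ))

/-- `|log(q)| ≥ 0`. PROVED. [claim: Mochizuki2012, status: disputed] -/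
theorem absLogq_nonneg (D : InitialThetaData F K Fbar E l Pb) : 0 ≤ absLogq D :=
  div_nonneg (logq_nonneg D) (by positivity)

/-! ## 2. The provenance link -/

/-- **`IsSettingOf D P`**: the Cor. 3.12 setting `P` (c312-7's `Cor312.Setting S`, over c312-1's `S : Thm311.Situation T`)
IS "the situation of Theorem 3.11" ([IUTchIII] p. 153 l. 3–8, p. 173 l. 41) RELATIVE TO THE GIVEN initial
Θ-data `D` ([IUTchI] Def. 3.1, L5-t2's `InitialThetaData F K Fbar E l Pb`). A HYPOTHESIS structure (never
asserted; no existence claimed) recording the identifications between the two sides that are statable over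
the cell's present declarations — one field per printed clause, quoted:
* the index skeleton of Thm. 3.11 (c312-1's `ThetaIndex`: "`l⋇ = (l−1)/2`", "the valuations `V` (≅ `V_mod`, Def.
  3.1 (e))", "`V^bad ⊆ V`") is that of `D` (`lstar_eq`, `places`);
* `𝕍(F)^bad` is finite (`VFbad_finite`; classical, cf. `logq`);
* the `q`-pilot log-volume of `P` is minus `(1/2l) · log(q)` of `D` (`negLogQ_eq`) — [IUTchIV] p. 23 l. 27–30
  quoted at `absLogq`; on the [IUTchIII] side this is Prop. 3.9 (iii) ("the global log-volume … is equal to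
  the degree of the arithmetic line bundle", L6-t4's `Prop39iii_degree`) applied to the `q`-pilot object of
  Def. 3.8 (i) ("determined by the `q_v`, for `v ∈ 𝕍^bad`", L6-t4's `qPilotObject`), procession-normalized
  (Prop. 3.9 (i)) — a constant family, cf. c312-3's `degLgp_const_qPilot`.
For c312-5's REAL index `T := Thm311.Real.thetaIndexOfInitial D hfin` (W2-A, `Thm311RealM.lean`) the two
index fields hold by construction (`V = ↥D.V`, `V^bad = D.Vbad`, `l⋇` from `l`); they are kept as hypotheses here
so that ANY index skeleton equivalent to `D`'s (e.g. c312-5's `Real.thetaIndex X` over Dupuy–Hilado pilot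
data) can be linked. The constructions that produce `P`'s remaining fields from `D` ([IUTchI] §4–§6: the Θ^{±ell}NF-Hodge theaters
`P.HT`, Def. 6.13; [IUTchII] §4: the `𝓕^⊩`-prime-strips `P.Strip`, Def. 4.9, and `†𝒞^⊩_△`, Cor. 4.10 (i);
[IUTchIII] §1–§3: the log-links `P.LogLink`, Def. 1.1, the LGP-Gaussian log-theta-lattice `P.lattice`, Def.
3.8 (iii), the Prop. 3.7 output `P.sig`, the packets and Kummer glue `S.L`, `P.thetaRegionOf`, `P.qRegionOf`,
Thm. 3.11 (i)(ii)) are exactly c312-7's `Setting` fields with their residual owners (R0–R3 of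
`Cor312Statement.lean`), not re-typed here. [claim: Mochizuki2012, status: disputed] -/
structure IsSettingOf (D : InitialThetaData F K Fbar E l Pb) {T : Thm311.ThetaIndex} {S : Thm311.Situation T}
    (P : Cor312.Setting S) : Prop where
  /-- [IUTchI] Def. 3.1 (c) "`l ≥ 5` a prime"; Thm. 3.11's labels `j ∈ 𝔽_l^⋇ = {1, …, l⋇}`: `l⋇ = (l − 1)/2`. -/
  lstar_eq : T.lstar = (l - 1) / 2
  /-- [IUTchI] Def. 3.1 (e) "`V̲ ⊆ V(K)` … induces a natural bijection `V̲ ⥲ V_mod`"; Thm. 3.11 p. 153 "Fix a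
  collection of initial Θ-data": the index set of places of the multiradial representation is `D.V = V̲`,
  with "`V^bad`" = `V̲^bad` (the members of `V̲` over `V^bad_mod`). -/
  places : ∃ e : T.V ≃ D.V, ∀ v : T.V, v ∈ T.Vbad ↔ ((e v : D.V) : Val K) ∈ D.Vbad
  /-- `𝕍(F)^bad = 𝕍^bad_mod ×_{𝕍_mod} 𝕍(F)` is finite (finitely many places of bad multiplicative reduction;
  the tree's classical FACT `WeierstrassCurve.finite_badPlaces`). -/
  VFbad_finite : D.VFbad.Finite
  /-- [IUTchIV] p. 23 l. 27–30: "the quantity «`|log(q)| ∈ ℝ_{>0}`» defined in [IUTchIII], Corollary 3.12, is equal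
  to `(1/2l) · log(q)`": the procession-normalized mono-analytic log-volume `−|log(q)|` of the image of the
  `q`-pilot object in `P` is `−(1/2l) · log(q)` of `D`. -/
  negLogQ_eq : P.negLogQ = -absLogq D

/-! ## 3. The numbers of Theorem 1.10 for `(D, P)` and the bridge to the skeleton -/

/-- The data of [IUTchIV] Theorem 1.10 (kurims pp. 22–23) for the initial Θ-datum `D` that are NOT determined
by the setting of Cor. 3.12 and not (yet) computed from `D` by the cell — carried as INPUTS, each with its
printed sign: `e*_mod := 2^{12}·3^3·5·e_mod`, `e_mod` "the maximal ramification index of `F_mod` … over `ℚ`"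
(p. 22); `η_prm`, the constant of [IUTchIV] Prop. 1.6 (campaign-S `Thm110Numerics.etaPrm`); `log(𝔡^{F_tpd}) +
log(𝔣^{F_tpd}) ∈ ℝ_{≥0}`, `F_tpd := F_mod(E_{F_mod}[2])` (p. 22–23); and the two printed side conditions: "`l ≠ 5`"
(p. 22, last lines: "it follows … from [IUTchI], Definition 3.1, (c), that `l ≠ 5`"; with `l ≥ 5` prime,
`l ≥ 7`, as the skeleton's `Thm110Data.seven_le_l` requires) and `log(q) > 0` (p. 23: "`𝕍(F□)^bad … (≠ ∅)`";
Cor. 3.12: "`|log(q)| > 0` is easily computed in terms of the various `q`-parameters … at `v ∈ 𝕍^bad (≠ ∅)`" —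
provable from `D` once the tree's FACT `ordMinimalDiscriminant_eq_zero_iff` is discharged; an input here).
[claim: Mochizuki2012, status: disputed] -/
structure Thm110Inputs (D : InitialThetaData F K Fbar E l Pb) : Type where
  /-- `l ≥ 7` ("`l ≠ 5`", [IUTchIV] Thm. 1.10) -/
  seven_le_l : 7 ≤ l
  /-- `log(q) > 0` (`𝕍^bad ≠ ∅`) -/
  logq_pos : 0 < logq D
  /-- `e*_mod = 2^{12}·3^3·5·e_mod` -/
  estar : ℝ
  /-- `e*_mod ≥ 0` -/
  estar_nonneg : 0 ≤ estar
  /-- `η_prm` of [IUTchIV] Prop. 1.6 -/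
  eta : ℝ
  /-- `η_prm ≥ 0` -/
  eta_nonneg : 0 ≤ eta
  /-- `log(𝔡^{F_tpd}) + log(𝔣^{F_tpd})` -/
  logdf : ℝ
  /-- `≥ 0` -/
  logdf_nonneg : 0 ≤ logdf

/-- **`numbersOf D P I`**: the skeleton's `Thm110Data` ([IUTchIV] Thm. 1.10 verbatim, `ForkThm110.lean`) OF the
initial Θ-datum `D` and the Cor. 3.12 setting `P`: `l`, `d_mod := [F_mod : ℚ]`, `log(q) := logq D`, the inputs `I`,
and `−|log(Θ)| :=` the real number `P.negLogTheta` when "`−|log(Θ)| ∈ ℝ`". JUNK-VALUE NOTE (documented design):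
`Thm110Data.negLogTheta` is a real number while the printed `−|log(Θ)|` lives in `ℝ ∪ {+∞}` (`P.negLogTheta :
WithTop ℝ`); in the branch `P.negLogTheta = ⊤` we store the junk value `−|log(q)| − 1`, chosen so that the
skeleton's `Cor312` (`−|log(q)| ≤ −|log(Θ)|`) is FALSE there — exactly as the verbatim `Statement` (whose first
conjunct is "`−|log(Θ)| ∈ ℝ`") is; `numbersOf_negLogTheta_of_eq` gives the honest branch.
[claim: Mochizuki2012, status: disputed] -/
def numbersOf (D : InitialThetaData F K Fbar E l Pb) {T : Thm311.ThetaIndex} {S : Thm311.Situation T}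
    (P : Cor312.Setting S) (I : Thm110Inputs D) : Thm110Data where
  l := l
  seven_le_l := I.seven_le_l
  dmod := dmod E
  one_le_dmod := one_le_dmod E
  estar := I.estar
  estar_nonneg := I.estar_nonneg
  eta := I.eta
  eta_nonneg := I.eta_nonneg
  logdf := I.logdf
  logdf_nonneg := I.logdf_nonneg
  logq := logq D
  logq_pos := I.logq_pos
  negLogTheta := P.negLogTheta.untopD (-absLogq D - 1)

variable {D : InitialThetaData F K Fbar E l Pb} {T : Thm311.ThetaIndex} {S : Thm311.Situation T}
  (P : Cor312.Setting S) (I : Thm110Inputs D)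

/-- The skeleton's `|log(q)| = log(q)/2l` of `numbersOf D P I` is `absLogq D`. PROVED (`rfl`).
[claim: Mochizuki2012, status: disputed] -/
theorem numbersOf_absLogq : (numbersOf D P I).absLogq = absLogq D := rfl

/-- `numbersOf` carries the prime `l` of the datum (rfl; asked for by the `HeightFamily` side, skel
`Thm110Family.l_eq`). [claim: Mochizuki2012, status: disputed] -/
theorem numbersOf_l : (numbersOf D P I).l = l := rfl

/-- `numbersOf` carries `d_mod = [F_mod : ℚ]` of the datum (rfl). [claim: Mochizuki2012, status: disputed] -/
theorem numbersOf_dmod : (numbersOf D P I).dmod = dmod E := rfl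

/-- `numbersOf` carries `log(q)` OF THE DATUM, not a number read off the setting (rfl; plan's precision P1/P3:
the `HeightFamily` side needs `(numbersOf D P I).logq = log 𝔮(D)`, skel `Thm110Family.logq_eq`).
[claim: Mochizuki2012, status: disputed] -/
theorem numbersOf_logq : (numbersOf D P I).logq = logq D := rfl

/-- Honest branch of the junk-value note: when `−|log(Θ)| = x ∈ ℝ`, `numbersOf` stores `x`. PROVED.
[claim: Mochizuki2012, status: disputed] -/
theorem numbersOf_negLogTheta_of_eq {x : ℝ} (hx : P.negLogTheta = (x : WithTop ℝ)) :
    (numbersOf D P I).negLogTheta = x := by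
  show P.negLogTheta.untopD _ = x
  rw [hx]; rfl

/-- The case analysis behind both bridges: under the link, the verbatim statement of Cor. 3.12 for `P`
("`−|log(Θ)| ∈ ℝ`, and `−|log(Θ)| ≥ −|log(q)|`") holds iff `−|log(q)|` of the datum is `≤` the untopped
`−|log(Θ)|` with the junk value `−|log(q)| − 1` at `+∞` (see `numbersOf`). PROVED (uses only `negLogQ_eq`).
[claim: Mochizuki2012, status: disputed] -/
theorem statement_iff_untopD (h : IsSettingOf D P) :
    P.Statement ↔ -absLogq D ≤ P.negLogTheta.untopD (-absLogq D - 1) := by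
  unfold Cor312.Setting.Statement
  rw [h.negLogQ_eq]
  rcases em (P.negLogTheta = ⊤) with htop | hfin
  · -- `−|log(Θ)| = +∞`: both sides are false
    rw [htop]
    constructor
    · rintro ⟨hne, -⟩; exact absurd rfl hne
    · intro hle
      have hle' : -absLogq D ≤ -absLogq D - 1 := hle
      linarith
  · obtain ⟨x, hx⟩ := WithTop.ne_top_iff_exists.mp hfin
    rw [← hx]
    constructor
    · rintro ⟨-, hle⟩; exact WithTop.coe_le_coe.mp hle
    · intro hle; exact ⟨WithTop.coe_ne_top, WithTop.coe_le_coe.mpr hle⟩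

/-- **The bridge** (skeleton side): under the provenance link, the skeleton's per-curve hypothesis
`Thm110Data.Cor312` (`−|log(q)| ≤ −|log(Θ)|`, `ForkThm110.lean`; = the kernel-DAG node `N_IUTchIII_Cor3_12`) for
the numbers OF `(D, P)` is EQUIVALENT to the VERBATIM statement of [IUTchIII] Cor. 3.12 for `P` (c312-7's
`Cor312.Setting.Statement`: "`−|log(Θ)| ∈ ℝ`, and `−|log(Θ)| ≥ −|log(q)|`"). PROVED.
[claim: Mochizuki2012, status: disputed] -/
theorem numbersOf_cor312_iff (h : IsSettingOf D P) : (numbersOf D P I).Cor312 ↔ P.Statement :=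
  (statement_iff_untopD P h).symm

/-- The verbatim statement in terms of the datum's `log(q)`: under the link, Cor. 3.12 for `P` reads
"`−|log(Θ)| = x ∈ ℝ` for some `x` with `−(1/2l)·log(q) ≤ x`". PROVED. [claim: Mochizuki2012, status: disputed] -/
theorem statement_iff_exists (h : IsSettingOf D P) :
    P.Statement ↔ ∃ x : ℝ, P.negLogTheta = (x : WithTop ℝ) ∧ -absLogq D ≤ x := by
  unfold Cor312.Setting.Statement
  rw [h.negLogQ_eq]
  constructor
  · rintro ⟨hne, hle⟩
    obtain ⟨x, hx⟩ := WithTop.ne_top_iff_exists.mp hne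
    exact ⟨x, hx.symm, WithTop.coe_le_coe.mp (hx ▸ hle)⟩
  · rintro ⟨x, hx, hle⟩
    rw [hx]
    exact ⟨WithTop.coe_ne_top, WithTop.coe_le_coe.mpr hle⟩

/-- Under the link, the printed positivity clause of Cor. 3.12 for `P` ("`|log(q)| > 0`", c312-7's
`AbsLogQPos : P.negLogQ < 0`) is the positivity of the datum's `log(q)` (`l ≥ 1`). PROVED.
[claim: Mochizuki2012, status: disputed] -/
theorem absLogQPos_iff (h : IsSettingOf D P) (hl : 1 ≤ l) : P.AbsLogQPos ↔ 0 < logq D := by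
  unfold Cor312.Setting.AbsLogQPos
  rw [h.negLogQ_eq, neg_lt_zero, absLogq]
  have hl' : (0 : ℝ) < 2 * (l : ℝ) := by
    have : (1 : ℝ) ≤ l := by exact_mod_cast hl
    linarith
  constructor
  · intro hpos
    by_contra hle
    have : logq D / (2 * (l : ℝ)) ≤ 0 := div_nonpos_of_nonpos_of_nonneg (not_lt.mp hle) hl'.le
    linarith
  · intro hpos; exact div_pos hpos hl'

/-! ## 4. The same numbers on campaign S's carrier `Thm110Numerics` ([IUTchIV] Thm. 1.10 as PROVED modulo `Cor312`) -/

/-- The [IUTchIV]-side inputs for campaign S's carrier `Literature.IUT.LogVolume.Thm110Numerics` (abc-iut-S3,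
`Theorem110Data.lean`; its `theorem110` consumes `X.Cor312` as THE disputed hypothesis): `e_mod` with
`1 ≤ e_mod ≤ d_mod`, `η_prm > 0`, the four log-different/log-conductor degrees `≥ 0`, and `log(q) > 0` — all for
the datum `D`; `l`, its primality and `l ≥ 5`, `d_mod` come FROM `D`. [claim: Mochizuki2012, status: disputed] -/
structure NumericsInputs (D : InitialThetaData F K Fbar E l Pb) : Type where
  /-- `e_mod`, "the maximal ramification index of `F_mod` … over `ℚ`" ([IUTchIV] p. 22) -/
  emod : ℕ
  /-- `1 ≤ e_mod` -/
  one_le_emod : 1 ≤ emod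
  /-- `e_mod ≤ d_mod` -/
  emod_le_dmod : emod ≤ dmod E
  /-- `η_prm` (Prop. 1.6) -/
  etaPrm : ℝ
  /-- `η_prm > 0` -/
  etaPrm_pos : 0 < etaPrm
  /-- `log(𝔡^{F_tpd}) ≥ 0` -/
  logDiffTpd : ℝ
  /-- as printed -/
  logDiffTpd_nonneg : 0 ≤ logDiffTpd
  /-- `log(𝔣^{F_tpd}) ≥ 0` -/
  logCondTpd : ℝ
  /-- as printed -/
  logCondTpd_nonneg : 0 ≤ logCondTpd
  /-- `log(𝔡^F) ≥ 0` -/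
  logDiffF : ℝ
  /-- as printed -/
  logDiffF_nonneg : 0 ≤ logDiffF
  /-- `log(𝔣^F) ≥ 0` -/
  logCondF : ℝ
  /-- as printed -/
  logCondF_nonneg : 0 ≤ logCondF
  /-- `log(q) > 0` (`𝕍^bad ≠ ∅`) -/
  logq_pos : 0 < logq D

/-- **`numericsOf D P J`**: campaign S's `Thm110Numerics` OF the datum `D` and the setting `P` — `l`, `l` prime,
`l ≥ 5` and `d_mod` FROM `D` (L5-t2's fields `l_prime`, `five_le_l`; `dmod`), `log(q) := logq D`, the inputs `J`,
`−|log(Θ)|` untopped with the documented junk value (as in `numbersOf`). [claim: Mochizuki2012, status: disputed] -/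
def numericsOf (D : InitialThetaData F K Fbar E l Pb) {T : Thm311.ThetaIndex} {S : Thm311.Situation T}
    (P : Cor312.Setting S) (J : NumericsInputs D) : Thm110Numerics where
  l := l
  prime_l := D.l_prime
  five_le_l := D.five_le_l
  dmod := dmod E
  one_le_dmod := one_le_dmod E
  emod := J.emod
  one_le_emod := J.one_le_emod
  emod_le_dmod := J.emod_le_dmod
  etaPrm := J.etaPrm
  etaPrm_pos := J.etaPrm_pos
  logDiffTpd := J.logDiffTpd
  logDiffTpd_nonneg := J.logDiffTpd_nonneg
  logCondTpd := J.logCondTpd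
  logCondTpd_nonneg := J.logCondTpd_nonneg
  logDiffF := J.logDiffF
  logDiffF_nonneg := J.logDiffF_nonneg
  logCondF := J.logCondF
  logCondF_nonneg := J.logCondF_nonneg
  logq := logq D
  logq_pos := J.logq_pos
  negLogTheta := P.negLogTheta.untopD (-absLogq D - 1)

variable (J : NumericsInputs D)

/-- rfl: `numericsOf` carries `log(q)` of the datum. [claim: Mochizuki2012, status: disputed] -/
theorem numericsOf_logq : (numericsOf D P J).logq = logq D := rfl

/-- rfl: `numericsOf` carries the prime `l` of the datum. [claim: Mochizuki2012, status: disputed] -/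
theorem numericsOf_l : (numericsOf D P J).l = l := rfl

/-- **The bridge** (campaign-S side): under the provenance link, S3's hypothesis `Thm110Numerics.Cor312`
(consumed by `Literature.IUT.LogVolume.theorem110`) for the numerics OF `(D, P)` is EQUIVALENT to the VERBATIM
statement of [IUTchIII] Cor. 3.12 for `P`. PROVED. [claim: Mochizuki2012, status: disputed] -/
theorem numericsOf_cor312_iff (h : IsSettingOf D P) : (numericsOf D P J).Cor312 ↔ P.Statement :=
  (statement_iff_untopD P h).symm

end Summit.ABC.IUTFork.Cor312Prov

end
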